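import Mathlib.Analysis.Matrix.Order
import Mathlib.Analysis.Matrix.Spectrum
import Mathlib.Analysis.MeanInequalities
import Mathlib.Analysis.SpecialFunctions.Pow.Real
import HarnessLib

/-!
# The determinant–trace AM–GM inequality (the algebraic core of the
# Aleksandrov–Bakelman–Pucci maximum principle)

For real positive semidefinite `n × n` matrices `a`, `A`:
`det a · det A ≤ (tr(aA)/n)ⁿ` — Gilbarg–Trudinger's inequality
`𝒟* |det D²u| ≤ (−a^{ij}D_{ij}u / n)ⁿ` on the upper contact set ((9.10) in the proof of
Lemma 9.3 / Thm. 9.1), where `𝒟* = det[a^{ij}]` and `−D²u ≥ 0`.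

* `prod_le_pow_card_of_nonneg` — AM–GM: `∏ zᵢ ≤ (Σ zᵢ / n)ⁿ` for `zᵢ ≥ 0`;
* `PosSemidef.det_le_pow_trace` — `det M ≤ (tr M / n)ⁿ` for `M ≥ 0` (AM–GM on the eigenvalues);
* `det_mul_det_le_pow_trace` — `det a · det A ≤ (tr(aA)/n)ⁿ` for `a, A ≥ 0`
  (`M = a^{1/2} A a^{1/2}`, `CFC.sqrt`).

Vendored as the first ingredient of the ABP estimate (GT Thm. 9.1), itself the base of the
Krylov–Safonov weak Harnack inequality (GT Thm. 9.22) needed for the Evans–Krylov step of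
`Literature.Geometry.Riemannian.gurskyViaclovsky_pathClosed_weighted_four`.

## References

* D. Gilbarg, N. S. Trudinger, *Elliptic Partial Differential Equations of Second Order* (2001),
  §9.1, proof of Lemma 9.3 (the matrix inequality before (9.10)). [GilbargTrudinger2001]
-/

noncomputable section

open Matrix Finset
open scoped MatrixOrder

namespace Literature.Analysis.Matrix.ABP

variable {n : Type*} [Fintype n] [DecidableEq n]

omit [DecidableEq n] in
/-- **AM–GM**: `∏ zᵢ ≤ (Σ zᵢ / n)ⁿ` for nonnegative reals. [folklore] -/
theorem prod_le_pow_card_of_nonneg [Nonempty n] (z : n → ℝ) (hz : ∀ i, 0 ≤ z i) :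
    ∏ i, z i ≤ ((∑ i, z i) / Fintype.card n) ^ Fintype.card n := by
  have hN : (0 : ℝ) < Fintype.card n := by exact_mod_cast Fintype.card_pos
  have h := Real.geom_mean_le_arith_mean_weighted univ (fun _ ↦ 1 / (Fintype.card n : ℝ)) z
    (fun i _ ↦ by positivity) (by rw [sum_const, card_univ, nsmul_eq_mul]; field_simp)
    (fun i _ ↦ hz i)
  have hprod : ∏ i ∈ univ, z i ^ (1 / (Fintype.card n : ℝ)) =
      (∏ i, z i) ^ (1 / (Fintype.card n : ℝ)) :=
    Real.finsetProd_rpow univ z (fun i _ ↦ hz i) _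
  rw [hprod, ← mul_sum] at h
  have h0 : 0 ≤ ∏ i, z i := prod_nonneg fun i _ ↦ hz i
  calc ∏ i, z i = ((∏ i, z i) ^ (1 / (Fintype.card n : ℝ))) ^ (Fintype.card n : ℕ) := by
        rw [← Real.rpow_natCast, ← Real.rpow_mul h0, one_div_mul_cancel hN.ne', Real.rpow_one]
    _ ≤ (1 / (Fintype.card n : ℝ) * ∑ i, z i) ^ (Fintype.card n : ℕ) :=
        pow_le_pow_left₀ (Real.rpow_nonneg h0 _) h _
    _ = ((∑ i, z i) / Fintype.card n) ^ Fintype.card n := by ring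

/-- **`det M ≤ (tr M / n)ⁿ` for a positive semidefinite real matrix** (AM–GM on the
eigenvalues). [cite: GilbargTrudinger2001, §9.1, proof of Lemma 9.3] -/
theorem det_le_pow_trace_of_posSemidef [Nonempty n] {M : Matrix n n ℝ} (hM : M.PosSemidef) :
    M.det ≤ (M.trace / Fintype.card n) ^ Fintype.card n := by
  have hdet : M.det = ∏ i, hM.1.eigenvalues i := by
    rw [hM.1.det_eq_prod_eigenvalues]; simp
  have htr : M.trace = ∑ i, hM.1.eigenvalues i := by
    rw [hM.1.trace_eq_sum_eigenvalues]; simp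
  rw [hdet, htr]
  exact prod_le_pow_card_of_nonneg _ fun i ↦ hM.eigenvalues_nonneg i

/-- **The determinant–trace AM–GM inequality**: for positive semidefinite real `a`, `A`,
`det a · det A ≤ (tr(aA)/n)ⁿ` (apply the previous lemma to `a^{1/2} A a^{1/2} ≥ 0`, whose
determinant is `det a · det A` and whose trace is `tr(aA)`). Gilbarg–Trudinger use it as
`𝒟*|det D²u| ≤ (−a^{ij}D_{ij}u/n)ⁿ` on the upper contact set.
[cite: GilbargTrudinger2001, §9.1, proof of Lemma 9.3] -/
theorem det_mul_det_le_pow_trace [Nonempty n] {a A : Matrix n n ℝ} (ha : a.PosSemidef)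
    (hA : A.PosSemidef) :
    a.det * A.det ≤ ((a * A).trace / Fintype.card n) ^ Fintype.card n := by
  have ha0 : 0 ≤ a := ha.nonneg
  set S : Matrix n n ℝ := CFC.sqrt a with hS
  have hSpsd : S.PosSemidef := (CFC.sqrt_nonneg a).posSemidef
  have hSS : S * S = a := CFC.sqrt_mul_sqrt_self a
  have hSH : Sᴴ = S := hSpsd.1
  -- `M = S A Sᴴ ≥ 0`
  have hM : (S * A * Sᴴ).PosSemidef := hA.mul_mul_conjTranspose_same S
  have hdetM : (S * A * Sᴴ).det = a.det * A.det := by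
    rw [det_mul, det_mul, hSH, ← hSS, det_mul]; ring
  have htrM : (S * A * Sᴴ).trace = (a * A).trace := by
    rw [hSH, Matrix.mul_assoc, trace_mul_comm, Matrix.mul_assoc, hSS, trace_mul_comm]
  rw [← hdetM, ← htrM]
  exact det_le_pow_trace_of_posSemidef hM

end Literature.Analysis.Matrix.ABP

end
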